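import Summits.Schanuel.Schanuel.Theorems.DiophantineDichotomyApproximationPropertyDefs

/-!
# Stub-ideation k1 (RECOGNISE & IMPORT) — helper-lemma SIGNATURES for stub `CycleAPIAt3 : CycleAPIAt 3`

Crux stmt-Schanuel-6117 `ApproximationProperty`, line `orbit-interpolation-determinant`, skeleton v7.
Planner `planner-sidea-stmt-Schanuel-6117-CycleAPIAt3-1-0`, 2026-08-16.  Statements only (`sorry`);
the plan is `Cruxes/ApproximationProperty/STUB-IDEAS-CycleAPIAt3-1.md`.  Every constant used below is an
existing declaration (`Rx`, `ideg`, `iheight`, `iabs`, `normAt`, `projDist`, `projZeros`, `rho`,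
`IsUnmixedOfRank`, `maxNorm`, `height` from `Literature.NumberTheory.Transcendental.Nesterenko`;
`CycleAPIAt` etc. from `…ApproximationPropertyDefs`).
-/

set_option linter.dupNamespace false

noncomputable section

attribute [local instance] MvPolynomial.gradedAlgebra

namespace Summit.Schanuel.Schanuel.Cruxes.ApproximationProperty.OrbitInterpolationDeterminant

open Literature.NumberTheory.Transcendental.Nesterenko MvPolynomial
open scoped BigOperators

/-- **H1 `helper_clause_mono_level`** (XS).  The interpolation clause of a 0-dimensional homogeneous
prime is monotone in the level: `H_𝔭` is non-decreasing (`hilbert_mono_of_isPrime`,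
`…HilbertTruncation`) and bounded by `ideg 𝔭 1` (`Nesterenko.hilbert_le_of_isPrime`, `s = 0`).
Used to carry a clause obtained at level `9Δ − 2` (H5) or `deg − 1` (`rankOne_interpolation_of_ideg_le`)
up to the stub's level `⌊c_f Δ⌋` after the final constant `c_f` is enlarged (two-constant trick). -/
theorem helper_clause_mono_level (m : ℕ) (𝔭 : Ideal (Rx m)) (h𝔭 : 𝔭.IsPrime)
    (hhom : 𝔭.IsHomogeneous (homogeneousSubmodule (Fin (m + 1)) ℚ)) (hr : IsUnmixedOfRank 𝔭 1)
    {δ δ' : ℕ} (hδ : δ ≤ δ')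
    (h : Module.finrank ℚ ↥(homogeneousSubmodule (Fin (m + 1)) ℚ δ) =
      Module.finrank ℚ ↥(homogeneousSubmodule (Fin (m + 1)) ℚ δ ⊓ 𝔭.restrictScalars ℚ) + ideg 𝔭 1) :
    Module.finrank ℚ ↥(homogeneousSubmodule (Fin (m + 1)) ℚ δ') =
      Module.finrank ℚ ↥(homogeneousSubmodule (Fin (m + 1)) ℚ δ' ⊓ 𝔭.restrictScalars ℚ) +
        ideg 𝔭 1 := by
  sorry

/-- **H2 `helper_normAt_linear_le_projDist`** (XS).  A linear form vanishing at `β` is small at every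
point projectively close to `β`:  `‖L‖_ω ≤ (m+1)·dist(ω, β)`.  (Proof: with `|β_i| = ‖β‖`,
`L(ω)β_i = Σ_j a_j (ω_j β_i − ω_i β_j)`.)  Transport datum for LINE containers (the lead's
"transport ℙ¹ ↔ line": the two linear forms of a rational line close to `ω̄` are small at `ω̄`). -/
theorem helper_normAt_linear_le_projDist (m : ℕ) (L : Rx m) (hL : L.IsHomogeneous 1) (hL0 : L ≠ 0)
    (β ω : Fin (m + 1) → ℂ) (hβ : β ≠ 0) (hω : ω ≠ 0) (hLβ : aeval β L = 0) :
    normAt ω L ≤ (m + 1) * projDist ω β := by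
  sorry

/-- **H3 `helper_orbit_accuracy_cap`** (M) — PACKING: an orbit all of whose points stay at projective
distance `≥ ρ` from `ω̄ = (1:ω)` cannot be much smaller at `ω̄` than `ρ` allows:
`log(1/|𝔮(ω̄)|) ≤ C·(D log(D+2) + L + √((D·h(𝔮) + D² log(D+2))·L))`, `L = log(1/ρ)`, `D = deg 𝔮`.
Ingredients (all LANDED): `ZeroDimDictionary` (C),(D) (`|𝔮(ω̄)| ≥ e^{−cD} ∏_σ dist(ω̄, σb)`,
`h_K(b) ≤ h(𝔮) + c·D`), `OrbitClusterBound` at `t = 1` applied to a `ℚ`-linear projection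
`y ↦ y₁ + λy₂ + λ²y₃` (`λ ≤ 3D²`) injective on the orbit (exponent-2 packing on `ℙ¹`:
`k(a)² · a ≲ D·h(𝔮) + D² log D` conjugates within `e^{−a}`), and the layer-cake identity
`Σ_σ min(L, log(1/dist_σ)) = ∫₀ᴸ k(a) da`.  In the stub: a qualifying orbit
(`log(1/|𝔮(ω̄)|) ≥ (Δh(𝔮)+YD)/c_d`) lying on a satellite curve `C'` forces
`log(1/dist(ω̄, C')) ≥ (Δ/(24 c_d²))·(Δ·h(𝔮)/D + Y) − O(1)` — D-free, linear in `Δ`. -/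
theorem helper_orbit_accuracy_cap (m : ℕ) (hm : 1 ≤ m) (ω : Fin m → ℂ) : ∃ C : ℝ, 0 < C ∧
    ∀ (𝔮 : Ideal (Rx m)) (ρ : ℝ), 𝔮.IsPrime → 𝔮.IsHomogeneous (homogeneousSubmodule (Fin (m + 1)) ℚ) →
      IsUnmixedOfRank 𝔮 1 → 0 < ρ → ρ ≤ Real.exp (-1) →
      (∀ β ∈ projZeros 𝔮, ρ ≤ projDist (Fin.cons 1 ω) β) →
      Real.log (1 / iabs 𝔮 1 (Fin.cons 1 ω)) ≤
        C * ((ideg 𝔮 1 : ℝ) * Real.log ((ideg 𝔮 1 : ℝ) + 2) + Real.log (1 / ρ) +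
          Real.sqrt (((ideg 𝔮 1 : ℝ) * iheight 𝔮 1 +
              (ideg 𝔮 1 : ℝ) ^ 2 * Real.log ((ideg 𝔮 1 : ℝ) + 2)) * Real.log (1 / ρ))) := by
  sorry

/-- **H4 `helper_containerRestart`** (M) — RESTART ON A CLOSE CONTAINER, directly in `ℙ³` (no transport):
a `ℚ`-curve `V(𝔮)` (`𝔮` prime of rank 2) lying on the complete intersection `(Q, R)` (this gives the
tree's Hilbert lower bound `curveOnCI_hilbertLowerBound`: `H(𝔮; ν) ≥ (ν − a − b)·deg 𝔮`) that passes
within `exp(−C(Δ/c + 1)(Δ h(𝔮) + Y deg 𝔮))` of `ω̄` is re-cut, in degree `3⌊Δ⌋`, by a small form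
`F ∉ 𝔮` from `boxPrinciple_modIdeal` (registered) and `small_prime_of_cut` (registered, `r = 2`), the
container's own value being `|𝔮(ω̄)| ≤ ρ·e^{45 deg 𝔮}` (tree `NesterenkoPhilippon2001_ch3_cor_4_10_holds`).
Output: a prime orbit `𝔯 ⊇ 𝔮` meeting the `CycleAPIAt 3` matrix with constant `c`, of degree
`≤ 3Δ·deg 𝔮 ≤ ⌊cΔ⌋ + 1`, so its clause is AUTOMATIC (`rankOne_interpolation_of_ideg_le`, registered). -/
theorem helper_containerRestart (ω : Fin 3 → ℂ) : ∃ C : ℝ, 1 ≤ C ∧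
    ∀ (Q R : Rx 3) (a b : ℕ) (𝔮 : Ideal (Rx 3)),
      Q ≠ 0 → Q.IsHomogeneous a → R.IsHomogeneous b → 1 ≤ a → 1 ≤ b →
      (Ideal.span {Q}).IsPrime → R ∉ Ideal.span {Q} →
      𝔮.IsPrime → 𝔮.IsHomogeneous (homogeneousSubmodule (Fin (3 + 1)) ℚ) → IsUnmixedOfRank 𝔮 2 →
      Q ∈ 𝔮 → R ∈ 𝔮 →
    ∀ (c Δ Y : ℝ), C * (ideg 𝔮 2 : ℝ) ≤ c → c ≤ Δ → Δ ≤ Y → (a : ℝ) + b ≤ Δ →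
      rho (Fin.cons 1 ω) 𝔮 ≤ Real.exp (-(C * (Δ / c + 1) * (Δ * iheight 𝔮 2 + Y * ideg 𝔮 2))) →
      ∃ 𝔯 : Ideal (Rx 3), 𝔯.IsPrime ∧ 𝔯.IsHomogeneous (homogeneousSubmodule (Fin (3 + 1)) ℚ) ∧
        IsUnmixedOfRank 𝔯 1 ∧ 𝔮 ≤ 𝔯 ∧
        (ideg 𝔯 1 : ℝ) ≤ 3 * Δ * ideg 𝔮 2 ∧
        iheight 𝔯 1 ≤ C * (Δ * iheight 𝔮 2 + Y * ideg 𝔮 2) ∧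
        iabs 𝔯 1 (Fin.cons 1 ω) ≤ Real.exp (-((Δ * iheight 𝔯 1 + Y * ideg 𝔯 1) / c)) := by
  sorry

/-- **H5 `helper_isolatedOrbit_clause`** (L, IMPORT: Chardin–Philippon, *Régularité et interpolation*,
J. Algebraic Geom. 8 (1999), the dimension-0 case — the ISOLATED points of a scheme cut out by forms of
degree `≤ δ₀` in `ℙᵐ` impose independent conditions on forms of degree `≥ m(δ₀ − 1) + 1`; shared verbatim
with line `arithmetic-chardin-philippon` ("the KNOWN bridge", `r = 1` sharpening of its
`stub_geomHilbertLB`)).  In the stub: the descent's output orbit `𝔮 ⊇ (Q₁, P₂, P₃)` that is a MINIMAL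
prime of `(Q₁, P₂, P₃)` (= not on a satellite component) satisfies the clause at level `9Δ − 2`. -/
theorem helper_isolatedOrbit_clause (m k δ₀ : ℕ) (hm : 1 ≤ m) (g : Fin k → Rx m) (e : Fin k → ℕ)
    (hg : ∀ j, (g j).IsHomogeneous (e j) ∧ 1 ≤ e j ∧ e j ≤ δ₀)
    (𝔮 : Ideal (Rx m)) (h𝔮 : 𝔮.IsPrime) (hhom : 𝔮.IsHomogeneous (homogeneousSubmodule (Fin (m + 1)) ℚ))
    (hr : IsUnmixedOfRank 𝔮 1) (hmin : 𝔮 ∈ (Ideal.span (Set.range g)).minimalPrimes)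
    (ν : ℕ) (hν : m * (δ₀ - 1) + 1 ≤ ν) :
    Module.finrank ℚ ↥(homogeneousSubmodule (Fin (m + 1)) ℚ ν) =
      Module.finrank ℚ ↥(homogeneousSubmodule (Fin (m + 1)) ℚ ν ⊓ 𝔮.restrictScalars ℚ) +
        ideg 𝔮 1 := by
  sorry

/-- **H6 `helper_satellite_dichotomy`** (S, pure commutative algebra) — the case split of the assembly:
an orbit `𝔮 ⊇ (Q, P, T)` on the complete-intersection curve `(Q, P)` is either ISOLATED in `V(Q,P,T)`
(→ H5) or lies on a SATELLITE: a component `𝔮'` of `(Q, P)` (rank 2, homogeneous) contained in `V(T)`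
with `𝔮' < 𝔮` (→ H3, then H4 or the residual).  (`Ideal.exists_minimalPrimes_le` + Krull dimension
sandwich `1 < dim R/𝔮' ≤ 2`; minimal primes of homogeneous ideals are homogeneous.) -/
theorem helper_satellite_dichotomy (Q P T : Rx 3) (a b τ : ℕ) (hQ0 : Q ≠ 0) (hQ : Q.IsHomogeneous a)
    (hP : P.IsHomogeneous b) (hT : T.IsHomogeneous τ) (ha : 1 ≤ a) (hb : 1 ≤ b) (hτ : 1 ≤ τ)
    (hprime : (Ideal.span {Q}).IsPrime) (hPQ : P ∉ Ideal.span {Q})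
    (𝔮 : Ideal (Rx 3)) (h𝔮 : 𝔮.IsPrime) (hhom : 𝔮.IsHomogeneous (homogeneousSubmodule (Fin (3 + 1)) ℚ))
    (hr : IsUnmixedOfRank 𝔮 1) (hle : Ideal.span {Q} ⊔ Ideal.span {P} ⊔ Ideal.span {T} ≤ 𝔮) :
    𝔮 ∈ (Ideal.span {Q} ⊔ Ideal.span {P} ⊔ Ideal.span {T}).minimalPrimes ∨
    ∃ 𝔮' : Ideal (Rx 3), 𝔮'.IsPrime ∧ 𝔮'.IsHomogeneous (homogeneousSubmodule (Fin (3 + 1)) ℚ) ∧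
      IsUnmixedOfRank 𝔮' 2 ∧ 𝔮' ∈ (Ideal.span {Q} ⊔ Ideal.span {P}).minimalPrimes ∧
      Ideal.span {Q} ⊔ Ideal.span {P} ⊔ Ideal.span {T} ≤ 𝔮' ∧ 𝔮' < 𝔮 := by
  sorry

/-! ### Assembly shape (documentation only; the real composition is the lead's) -/

/-- The stub, from: the clause-free descent WITH its construction data (lead's `CycleAP3Prime`, enriched
to return `Q₁, P₂, P₃` and `𝔮 ⊇ (Q₁,P₂,P₃)`), H6 (split), H5 + H1 (isolated ⇒ clause at `⌊c_fΔ⌋`),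
H3 (on a satellite ⇒ the satellite is exponentially close), H4 + `rankOne_interpolation_of_ideg_le`
(satellite of degree `≤ δ*` ⇒ restart output with automatic clause), run with internal constant `c_d`
and final constant `c_f = M(δ*)·c_d²`.  NOT covered (the plan's bet / the disprover's target):
satellites of degree `> δ*`.  This `example` only records that the stub's statement is the target. -/
example (h : CycleAPIAt 3) : CycleAPIAt 3 := h

end Summit.Schanuel.Schanuel.Cruxes.ApproximationProperty.OrbitInterpolationDeterminant

end
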